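import Summits.CriticalPhenomena.PercolationContinuityZ3.Theorems.SahiBoxTP2BooleanSpinsCountable

/-!
# Box-TP₂ on `ι → X` (`ι` countable) ⟺ box-TP₂ of every finite-dimensional marginal `μ ∘ (J.restrict)⁻¹`

Support file of the Sahi cell (`prim-sahi`, typer seat, generation 12; `--supports stmt-CriticalPhenomena-4575`).

The user-facing form of the marginal criterion for an index set such as `ℤ^d`: a finite measure `μ` on `ι → X`
(`ι ≃ ℕ`, `X` a bounded lattice with measurable boxes) is box-TP₂ iff for every finite `J ⊆ ι` the law of `u|_J` is
box-TP₂ on `↥J → X` (`isBoxTP2_iff_forall_finset`).  ⇒ is restriction along `Subtype.val`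
(`IsBoxTP2.map_restrictComp`); ⇐ relabels by `e : ι ≃ ℕ` (`isBoxTP2_map_reindex_symm_iff`) and identifies the
initial-segment marginals of the relabelled law with the marginals on `firstIndices e d`, through the order
isomorphism `finsetFinIso e d : (↥(firstIndices e d) → X) ≃o (Fin d → X)`.  Unit-interval and Boolean specialisations.
No sorries, no new axioms.
-/

noncomputable section

namespace Summit.CriticalPhenomena.PercolationContinuityZ3.Theorems.SahiBoxTP2

open MeasureTheory ProbabilityTheory Set Filter Topology Function
open scoped ENNReal unitInterval

section Finset

variable {ι X : Type*}

/-- **Box-TP₂ passes to every finite-dimensional marginal** `μ ∘ (J.restrict)⁻¹`. [this work] -/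
theorem IsBoxTP2.map_finsetRestrict [Lattice X] [BoundedOrder X] [MeasurableSpace X] {μ : Measure (ι → X)}
    (hμ : IsBoxTP2 μ) (J : Finset ι) (hIcc : ∀ a b : ↥J → X, MeasurableSet (Icc a b)) :
    IsBoxTP2 (μ.map (J.restrict : (ι → X) → ↥J → X)) :=
  hμ.map_restrictComp Subtype.val_injective hIcc

variable [Preorder X]

/-- The order isomorphism `(↥(firstIndices e d) → X) ≃o (Fin d → X)` relabelling the first `d` indices. -/
def finsetFinIso (e : ι ≃ ℕ) (d : ℕ) : (↥(firstIndices e d) → X) ≃o (Fin d → X) where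
  toFun v := fun k => v ⟨e.symm k, symm_mem_firstIndices e k⟩
  invFun x := fun j => x ⟨e j, lt_of_mem_firstIndices j.2⟩
  left_inv v := by
    funext j
    simp only
    congr 1
    exact Subtype.ext (by simp)
  right_inv x := by
    funext k
    simp only
    congr 1
    exact Fin.ext (by simp)
  map_rel_iff' {v w} := by
    constructor
    · intro h j
      have hj := h ⟨e j, lt_of_mem_firstIndices j.2⟩
      simp only [Equiv.coe_fn_mk] at hj
      have e1 : (⟨e.symm (e j), symm_mem_firstIndices e ⟨e j, lt_of_mem_firstIndices j.2⟩⟩ : ↥(firstIndices e d)) = j :=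
        Subtype.ext (by simp)
      rwa [e1] at hj
    · intro h k
      exact h _

/-- `finsetFinIso` as a measurable equivalence. -/
def finsetFinMeasurableEquiv [MeasurableSpace X] (e : ι ≃ ℕ) (d : ℕ) : (↥(firstIndices e d) → X) ≃ᵐ (Fin d → X) where
  toEquiv := (finsetFinIso (X := X) e d).toEquiv
  measurable_toFun := measurable_pi_lambda _ fun _ => measurable_pi_apply _
  measurable_invFun := measurable_pi_lambda _ fun _ => measurable_pi_apply _

/-- `finsetFinIso` is a measurable embedding. [folklore] -/
theorem measurableEmbedding_finsetFinIso [MeasurableSpace X] (e : ι ≃ ℕ) (d : ℕ) :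
    MeasurableEmbedding (finsetFinIso (X := X) e d) :=
  (finsetFinMeasurableEquiv (X := X) e d).measurableEmbedding

/-- **The initial-segment marginals of the relabelled configuration are the relabelled marginals on the first `d`
indices.** [folklore] -/
theorem finRestrict_comp_reindex_symm (e : ι ≃ ℕ) (d : ℕ) :
    finRestrict d ∘ ((reindex (X := X) e).symm : (ι → X) → ℕ → X) =
      (finsetFinIso (X := X) e d) ∘ ((firstIndices e d).restrict : (ι → X) → ↥(firstIndices e d) → X) := by
  funext u k
  rfl

end Finset

section FinsetLattice

variable {ι X : Type*} [Lattice X] [BoundedOrder X] [MeasurableSpace X]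

/-- **Box-TP₂ of all finite-dimensional marginals gives box-TP₂** (`ι` countably infinite, continuity from above
along the enumeration). [this work] -/
theorem isBoxTP2_of_forall_finset (e : ι ≃ ℕ) {μ : Measure (ι → X)}
    [IsFiniteMeasure μ] (hIcc : ∀ (d : ℕ) (a b : Fin d → X), MeasurableSet (Icc a b))
    (h : ∀ J : Finset ι, IsBoxTP2 (μ.map (J.restrict : (ι → X) → ↥J → X))) : IsBoxTP2 μ := by
  rw [← isBoxTP2_map_reindex_symm_iff e μ]
  refine (isBoxTP2_iff_forall_map_finRestrict hIcc).2 fun d => ?_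
  rw [Measure.map_map (measurable_finRestrict d) (measurableEmbedding_reindex_symm e).measurable,
    finRestrict_comp_reindex_symm,
    ← Measure.map_map (measurableEmbedding_finsetFinIso e d).measurable (Finset.measurable_restrict _)]
  exact (h (firstIndices e d)).map_orderIso (finsetFinIso e d) (measurableEmbedding_finsetFinIso e d)

/-- **Box-TP₂ ⟺ box-TP₂ of every finite-dimensional marginal** (`ι` countably infinite). [this work] -/
theorem isBoxTP2_iff_forall_finset (e : ι ≃ ℕ) {μ : Measure (ι → X)}
    [IsFiniteMeasure μ] (hIcc : ∀ (d : ℕ) (a b : Fin d → X), MeasurableSet (Icc a b))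
    (hIccJ : ∀ (J : Finset ι) (a b : ↥J → X), MeasurableSet (Icc a b)) :
    IsBoxTP2 μ ↔ ∀ J : Finset ι, IsBoxTP2 (μ.map (J.restrict : (ι → X) → ↥J → X)) :=
  ⟨fun hμ J => hμ.map_finsetRestrict J (hIccJ J), isBoxTP2_of_forall_finset e hIcc⟩

/-- Unit-interval coordinates: **a finite measure on `ι → [0,1]` (`ι ≃ ℕ`) is box-TP₂ iff all its finite-dimensional
marginals are** — "all finite-dimensional distributions are MTP₂ on closed boxes". [this work] -/
theorem isBoxTP2_iff_forall_finset_unitInterval (e : ι ≃ ℕ) {μ : Measure (ι → I)} [IsFiniteMeasure μ] :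
    IsBoxTP2 μ ↔ ∀ J : Finset ι, IsBoxTP2 (μ.map (J.restrict : (ι → I) → ↥J → I)) :=
  isBoxTP2_iff_forall_finset e (fun _ _ _ => measurableSet_Icc) fun _ _ _ => measurableSet_Icc

/-- Two-valued coordinates: the same on `ι → Bool`. [this work] -/
theorem isBoxTP2_iff_forall_finset_bool (e : ι ≃ ℕ) {μ : Measure (ι → Bool)} [IsFiniteMeasure μ] :
    IsBoxTP2 μ ↔ ∀ J : Finset ι, IsBoxTP2 (μ.map (J.restrict : (ι → Bool) → ↥J → Bool)) :=
  isBoxTP2_iff_forall_finset e (fun _ _ _ => (Set.toFinite _).measurableSet)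
    fun _ _ _ => (Set.toFinite _).measurableSet

end FinsetLattice

end Summit.CriticalPhenomena.PercolationContinuityZ3.Theorems.SahiBoxTP2
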